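import Mathlib.Algebra.Module.Torsion.Basic
import Mathlib.RingTheory.Ideal.Quotient.Operations
import Mathlib.RingTheory.Ideal.Maps
import Mathlib.RingTheory.LocalRing.MaximalIdeal.Basic
import Mathlib.LinearAlgebra.Dual.Defs
import HarnessLib

/-!
# Route `RamifiedHeegnerPair`, crux U₁ `LeafRankOneUpperAtThree` (stmt-BirchSwinnertonDyer-26022), line `partnerdescent` —
# partner kernel: CORNER MODULES `eM` over the corner ring `A ⧸ (1 − e)` — transporting the global hypotheses to the local factor `𝕋_𝔪`

HONEST FRAMING. Theorems only; helper file (`--supports stmt-BirchSwinnertonDyer-26022 --as helper`); pure commutative algebra over Mathlib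
(`Submodule.torsionBySet` with its `Module (A ⧸ I)` structure), no number theory, no named fact, no `sorry`; nothing booked; BSD is proved for
no curve. Lead prover bsd-line-rhp-p2 g63, 2026-08-31. Companion of ‹…LeafPartnerOrdersLocalFactor› (the idempotent `e` of the factor `𝕋_𝔪`)
and ‹…LeafPartnerOrdersCongruenceLattice› (the assembled (G3♭ˢ) theorem, which is LOCAL).

WHY. The stub (G3♭ᶜ) `Partnerdescent.stub_cokernelFifthInCoordinates` is derived (LEAD-G63-ASSEMBLY.md §4) by running the assembled theorem
`LeafPartnerOrders.smul_sub_mem_annihilator_iff_forall_smul_mem` on the LOCAL FACTOR at `𝔪 = 𝔪_{f,3}`: `T := 𝕋_𝔪 = 𝕋̂ ⧸ (1 − e)`,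
`B := e·X̂_q(J_0(qrM))`, `Y := e·X̂_r(J′)`, with `e` the idempotent of ‹LocalFactor›. Its hypotheses (cyclic, faithful, perfect invariant
pairing, `B[Ann Y] ⊆ Y`) must be obtained from the GLOBAL typed inputs ((C3′) multiplicity one, faithfulness of `𝕋 ⊂ End B`, exact Eisenstein
p806900 + non-degeneracy, the projector clauses (C2′)). This file is that transport, in Mathlib generality: for a commutative ring `A`, an
idempotent `e ∈ A`, an `A`-module `M`, the CORNER MODULE is `M_e := torsionBySet A M (1 − e) = {m : (1 − e)m = 0} = eM`, a module over the corner
ring `A_e := A ⧸ (1 − e)` (Mathlib instances `Module (A ⧸ I) (torsionBySet A M I)`, `IsScalarTower O (A ⧸ I) (torsionBySet A M I)`).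

* `mem_corner_iff`, `smul_mem_corner` — `m ∈ M_e ⟺ e·m = m`; `e·m ∈ M_e`.
* `corner_sub_smul_mem_of_sub_smul_mem` — COSOCLE TRANSPORT: if `x − c·x₀ ∈ 𝔫·M` then `ex − c̄·(ex₀) ∈ 𝔫̄·M_e` (`𝔫̄` = image of `𝔫` in `A_e`); so
  (C3′) «`dim M/𝔫M ≤ 1`» gives «`M_e/𝔫̄M_e` is spanned by `e·x₀`» — the input of Nakayama (`span_singleton_eq_top_of_sup_maximalIdeal_smul_top`).
* `corner_span_sup_maximalIdeal_smul_eq_top` — the same, Nakayama-ready: if the corner ring at `𝔫` is local with maximal ideal over `𝔫`,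
  (C3′) gives `span{e·x₀} ⊔ 𝔪_{A_e}·M_e = ⊤`, the hypothesis of `span_singleton_eq_top_of_sup_maximalIdeal_smul_top` (p801603, Step 1a).
* `mk_eq_zero_of_forall_corner_smul_eq_zero` — FAITHFULNESS TRANSPORT: if `A` acts faithfully on `M`, then `t ∈ A` with `t·M_e = 0` has `t·e = 0`, so
  its image in `A_e` is `0` (`mk t = mk (te)`).
* `corner_pairing_nondegenerate`, `corner_pairing_eisenstein` — PAIRING TRANSPORT for an `A`-invariant `O`-bilinear `β` on `M`: non-degeneracy and the
  exact-Eisenstein property «`φ ∘ u ∈ β(M)` for all `φ`» descend to `M_e` (with `u` restricted), because `e` is `β`-self-adjoint.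
* `corner_projector` — a sub-`A`-module `Y ≤ M`: saturation and the projector clause «`u|_Y = N₀`, `u·M ⊆ Y`» descend to the corner (elementwise).

[cite: BourbakiAlgebraI1989, Ch. II §1 no. 8 (idempotents and direct decompositions)] [cite: StacksProject, Tag 04GG]
-/

set_option linter.dupNamespace false
set_option autoImplicit false

namespace Summit.BirchSwinnertonDyer.BirchSwinnertonDyer.Theorems.LeafPartnerOrders

open Submodule

section Corner

variable {A : Type*} [CommRing A] {M : Type*} [AddCommGroup M] [Module A M]

/-- Membership in the corner module: `m ∈ torsionBySet A M (span {1 − e})` iff `e·m = m`. [cite: BourbakiAlgebraI1989, Ch. II §1 no. 8] -/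
theorem mem_corner_iff (e : A) (m : M) :
    m ∈ torsionBySet A M (Ideal.span {1 - e} : Set A) ↔ e • m = m := by
  rw [mem_torsionBySet_iff]
  constructor
  · intro h
    have h1 := h ⟨1 - e, Ideal.mem_span_singleton_self _⟩
    rw [sub_smul, one_smul, sub_eq_zero] at h1
    exact h1.symm
  · rintro h ⟨a, ha⟩
    obtain ⟨c, rfl⟩ := Ideal.mem_span_singleton'.mp ha
    change (c * (1 - e)) • m = 0
    rw [mul_smul, sub_smul, one_smul, h, sub_self, smul_zero]

/-- For an idempotent `e`, `e·m` lies in the corner module. [cite: BourbakiAlgebraI1989, Ch. II §1 no. 8] -/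
theorem smul_mem_corner {e : A} (he : IsIdempotentElem e) (m : M) :
    e • m ∈ torsionBySet A M (Ideal.span {1 - e} : Set A) := by
  rw [mem_corner_iff, smul_smul, he.eq]

/-- **Cosocle transport.** If `x − c·x₀ ∈ 𝔫·M` for an ideal `𝔫` of `A`, then in the corner module
`e·x − (mk c)·(e·x₀) ∈ (𝔫.map mk)·M_e` over the corner ring `A ⧸ (1 − e)`. Hence (C3′) «every `x` is `c·x₀` modulo `𝔫M`» (multiplicity one in
cosocle form for `M = X_q(J_0(qrM))`, `𝔫 = 𝔪_{f,3}`) makes `M_e/𝔫̄M_e` spanned by `e·x₀` — the input of Nakayama over the local ring `𝕋_𝔪`.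
[cite: BourbakiAlgebraI1989, Ch. II §1 no. 8] -/
theorem corner_sub_smul_mem_of_sub_smul_mem {e : A} (he : IsIdempotentElem e) (𝔫 : Ideal A) {x x₀ : M} {c : A}
    (h : x - c • x₀ ∈ 𝔫 • (⊤ : Submodule A M)) :
    (⟨e • x, smul_mem_corner (M := M) he x⟩ : torsionBySet A M (Ideal.span {1 - e} : Set A)) -
        Ideal.Quotient.mk (Ideal.span {1 - e}) c • ⟨e • x₀, smul_mem_corner (M := M) he x₀⟩ ∈
      (𝔫.map (Ideal.Quotient.mk (Ideal.span {1 - e}))) •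
        (⊤ : Submodule (A ⧸ Ideal.span {1 - e}) (torsionBySet A M (Ideal.span {1 - e} : Set A))) := by
  -- `e·(𝔫·M) ⊆ 𝔫̄ · M_e`, by induction on the membership in `𝔫 • ⊤`
  have key : ∀ (y : M), y ∈ 𝔫 • (⊤ : Submodule A M) →
      (⟨e • y, smul_mem_corner (M := M) he y⟩ : torsionBySet A M (Ideal.span {1 - e} : Set A)) ∈
        (𝔫.map (Ideal.Quotient.mk (Ideal.span {1 - e}))) •
          (⊤ : Submodule (A ⧸ Ideal.span {1 - e}) (torsionBySet A M (Ideal.span {1 - e} : Set A))) := by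
    intro y hy
    induction hy using Submodule.smul_induction_on' with
    | smul a ha n _ =>
        have hmem : Ideal.Quotient.mk (Ideal.span {1 - e}) a ∈ 𝔫.map (Ideal.Quotient.mk (Ideal.span {1 - e})) :=
          Ideal.mem_map_of_mem _ ha
        have heq : (⟨e • (a • n), smul_mem_corner (M := M) he (a • n)⟩ : torsionBySet A M (Ideal.span {1 - e} : Set A)) =
            Ideal.Quotient.mk (Ideal.span {1 - e}) a • ⟨e • n, smul_mem_corner (M := M) he n⟩ := by
          apply Subtype.ext
          change e • (a • n) = a • (e • n)
          rw [smul_comm]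
        rw [heq]
        exact Submodule.smul_mem_smul hmem Submodule.mem_top
    | add y _ z _ hy hz =>
        have heq : (⟨e • (y + z), smul_mem_corner (M := M) he (y + z)⟩ : torsionBySet A M (Ideal.span {1 - e} : Set A)) =
            ⟨e • y, smul_mem_corner (M := M) he y⟩ + ⟨e • z, smul_mem_corner (M := M) he z⟩ := by
          apply Subtype.ext
          change e • (y + z) = e • y + e • z
          rw [smul_add]
        rw [heq]
        exact Submodule.add_mem _ hy hz
  have heq : (⟨e • x, smul_mem_corner (M := M) he x⟩ : torsionBySet A M (Ideal.span {1 - e} : Set A)) -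
      Ideal.Quotient.mk (Ideal.span {1 - e}) c • ⟨e • x₀, smul_mem_corner (M := M) he x₀⟩ =
      ⟨e • (x - c • x₀), smul_mem_corner (M := M) he _⟩ := by
    apply Subtype.ext
    change e • x - c • (e • x₀) = e • (x - c • x₀)
    rw [smul_sub, smul_comm]
  rw [heq]
  exact key _ h

/-- **Cyclicity transport, Nakayama-ready.** Let `e` be an idempotent whose corner ring `A ⧸ (1 − e)` is local with maximal ideal pulling back
to the ideal `𝔫` of `A` (‹LocalFactor›: `exists_isIdempotentElem_localFactor`, `comap_maximalIdeal_eq`). If `M/𝔫M` is spanned by the class of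
`x₀` — (C3′) multiplicity one in cosocle form: every `x ∈ M` is `c·x₀` modulo `𝔫·M` — then the corner module satisfies
`span{e·x₀} + 𝔪_{A_e}·M_e = M_e`, the hypothesis of Nakayama (`span_singleton_eq_top_of_sup_maximalIdeal_smul_top`, p801603): with `M_e` finitely
generated, `M_e = A_e·(e·x₀)` is cyclic — Step 1a of the derivation on `B_𝔪 = e·X̂_q(J_0(qrM))`. [cite: Matsumura1987, Thm. 2.3 (Nakayama)]
[cite: BourbakiAlgebraI1989, Ch. II §1 no. 8] -/
theorem corner_span_sup_maximalIdeal_smul_eq_top {e : A} (he : IsIdempotentElem e) (𝔫 : Ideal A)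
    [IsLocalRing (A ⧸ Ideal.span {1 - e})]
    (hcomap : (IsLocalRing.maximalIdeal (A ⧸ Ideal.span {1 - e})).comap (Ideal.Quotient.mk (Ideal.span {1 - e})) = 𝔫)
    {x₀ : M} (hgen : ∀ x : M, ∃ c : A, x - c • x₀ ∈ 𝔫 • (⊤ : Submodule A M)) :
    Submodule.span (A ⧸ Ideal.span {1 - e})
          {(⟨e • x₀, smul_mem_corner (M := M) he x₀⟩ : torsionBySet A M (Ideal.span {1 - e} : Set A))} ⊔
        IsLocalRing.maximalIdeal (A ⧸ Ideal.span {1 - e}) •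
          (⊤ : Submodule (A ⧸ Ideal.span {1 - e}) (torsionBySet A M (Ideal.span {1 - e} : Set A))) = ⊤ := by
  rw [eq_top_iff]
  rintro ⟨m, hm⟩ -
  obtain ⟨c, hc⟩ := hgen m
  have hme : e • m = m := (mem_corner_iff e m).mp hm
  have h1 := corner_sub_smul_mem_of_sub_smul_mem he 𝔫 hc
  -- `𝔫.map mk ≤ 𝔪_{A_e}`
  have hle : 𝔫.map (Ideal.Quotient.mk (Ideal.span {1 - e})) ≤ IsLocalRing.maximalIdeal (A ⧸ Ideal.span {1 - e}) := by
    rw [Ideal.map_le_iff_le_comap, hcomap]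
  have h2 : (⟨e • m, smul_mem_corner (M := M) he m⟩ : torsionBySet A M (Ideal.span {1 - e} : Set A)) -
      Ideal.Quotient.mk (Ideal.span {1 - e}) c • ⟨e • x₀, smul_mem_corner (M := M) he x₀⟩ ∈
      IsLocalRing.maximalIdeal (A ⧸ Ideal.span {1 - e}) •
        (⊤ : Submodule (A ⧸ Ideal.span {1 - e}) (torsionBySet A M (Ideal.span {1 - e} : Set A))) :=
    Submodule.smul_mono_left hle h1
  have heq : (⟨m, hm⟩ : torsionBySet A M (Ideal.span {1 - e} : Set A)) = ⟨e • m, smul_mem_corner (M := M) he m⟩ :=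
    Subtype.ext hme.symm
  rw [heq]
  have hsum : (⟨e • m, smul_mem_corner (M := M) he m⟩ : torsionBySet A M (Ideal.span {1 - e} : Set A)) =
      Ideal.Quotient.mk (Ideal.span {1 - e}) c • ⟨e • x₀, smul_mem_corner (M := M) he x₀⟩ +
        ((⟨e • m, smul_mem_corner (M := M) he m⟩ : torsionBySet A M (Ideal.span {1 - e} : Set A)) -
          Ideal.Quotient.mk (Ideal.span {1 - e}) c • ⟨e • x₀, smul_mem_corner (M := M) he x₀⟩) := by
    rw [add_sub_cancel]
  rw [hsum]
  exact Submodule.add_mem_sup (Submodule.smul_mem _ _ (Submodule.subset_span rfl)) h2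

/-- **Faithfulness transport.** If `A` acts faithfully on `M` and `t ∈ A` kills the corner module `M_e` (`e` idempotent), then `t·e = 0`,
so the image of `t` in the corner ring `A ⧸ (1 − e)` vanishes (`mk t = mk (t e)`). In the derivation: `𝕋̂ ⊂ End(B̂)` (flat base change of
`𝕋 ⊂ End B`) gives `𝕋_𝔪 ↪ End(B_𝔪)`. [cite: BourbakiAlgebraI1989, Ch. II §1 no. 8] -/
theorem mk_eq_zero_of_forall_corner_smul_eq_zero {e : A} (he : IsIdempotentElem e)
    (hfaith : ∀ t : A, (∀ m : M, t • m = 0) → t = 0) {t : A}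
    (ht : ∀ m ∈ torsionBySet A M (Ideal.span {1 - e} : Set A), t • m = 0) :
    Ideal.Quotient.mk (Ideal.span {1 - e}) t = 0 := by
  have hte : t * e = 0 := hfaith _ fun m ↦ by
    rw [mul_smul]; exact ht _ (smul_mem_corner (M := M) he m)
  have : t = t * (1 - e) := by rw [mul_sub, mul_one, hte, sub_zero]
  rw [Ideal.Quotient.eq_zero_iff_mem, this]
  exact Ideal.mul_mem_left _ t (Ideal.mem_span_singleton_self _)

end Corner

section Pairing

variable {O : Type*} [CommRing O] {A : Type*} [CommRing A] [Algebra O A]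
  {M : Type*} [AddCommGroup M] [Module O M] [Module A M] [IsScalarTower O A M]

omit [Algebra O A] [IsScalarTower O A M] in
/-- **Pairing transport, non-degeneracy.** An `A`-invariant `O`-bilinear pairing `β` on `M` (`β(ax, y) = β(x, ay)`) that is non-degenerate on
`M` is non-degenerate on the corner module `M_e` (`e` idempotent): if `β(x, y) = 0` for all `y ∈ M_e` then `β(x, m) = β(x, em) = 0` for all
`m`, as `x = ex`. [cite: BourbakiAlgebraI1989, Ch. IX §1 no. 1 (orthogonality)] -/
theorem corner_pairing_nondegenerate {e : A} (he : IsIdempotentElem e) (β : M →ₗ[O] M →ₗ[O] O)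
    (hinv : ∀ (a : A) (x y : M), β (a • x) y = β x (a • y)) (hnd : ∀ x : M, (∀ y : M, β x y = 0) → x = 0)
    {x : M} (hx : x ∈ torsionBySet A M (Ideal.span {1 - e} : Set A))
    (h : ∀ y ∈ torsionBySet A M (Ideal.span {1 - e} : Set A), β x y = 0) : x = 0 := by
  refine hnd x fun m ↦ ?_
  have hxe : e • x = x := (mem_corner_iff e x).mp hx
  rw [← hxe, hinv]
  exact h _ (smul_mem_corner (M := M) he m)

/-- **Pairing transport, exact Eisenstein.** If every `O`-functional `φ` of `M` composed with `u ∈ A` is represented (`β x = φ ∘ u` for some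
`x ∈ M`: the exact Eisenstein property `u·M^∨ ⊆ M` for a non-degenerate lattice pairing), then for every `O`-functional `ψ` of the corner
module `M_e` there is `x ∈ M_e` with `β(x, y) = ψ(u·y)` for all `y ∈ M_e` (extend `ψ` by `m ↦ ψ(em)`, represent, and cut by `e`). With `u`
a unit of the corner ring (`isUnit_mk_span_of_not_mem`: `u = T_ℓ − ℓ − 1 ∉ 𝔪`) this is the hypothesis of `bijective_of_forall_exists_eq_comp` on
`B_𝔪`. [cite: BourbakiAlgebraI1989, Ch. IX §1 no. 1] -/
theorem corner_pairing_eisenstein {e : A} (he : IsIdempotentElem e) (β : M →ₗ[O] M →ₗ[O] O)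
    (hinv : ∀ (a : A) (x y : M), β (a • x) y = β x (a • y)) (u : A)
    (hEis : ∀ φ : Module.Dual O M, ∃ x : M, ∀ y : M, β x y = φ (u • y))
    (ψ : Module.Dual O (torsionBySet A M (Ideal.span {1 - e} : Set A))) :
    ∃ x ∈ torsionBySet A M (Ideal.span {1 - e} : Set A),
      ∀ y (hy : y ∈ torsionBySet A M (Ideal.span {1 - e} : Set A)), β x y = ψ ⟨u • y, Submodule.smul_mem _ u hy⟩ := by
  -- the projector `m ↦ e • m` into the corner, as an `O`-linear map
  let π : M →ₗ[O] torsionBySet A M (Ideal.span {1 - e} : Set A) :=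
    { toFun := fun m ↦ ⟨e • m, smul_mem_corner (M := M) he m⟩
      map_add' := fun m m' ↦ by apply Subtype.ext; change e • (m + m') = e • m + e • m'; rw [smul_add]
      map_smul' := fun c m ↦ by apply Subtype.ext; change e • (c • m) = c • (e • m); rw [smul_comm] }
  obtain ⟨x, hx⟩ := hEis (ψ ∘ₗ π)
  refine ⟨e • x, smul_mem_corner (M := M) he x, fun y hy ↦ ?_⟩
  have hye : e • y = y := (mem_corner_iff e y).mp hy
  rw [hinv, hye, hx]
  change ψ ⟨e • (u • y), _⟩ = ψ ⟨u • y, _⟩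
  congr 1
  apply Subtype.ext
  change e • (u • y) = u • y
  rw [smul_comm, hye]

end Pairing

section Sub

variable {A : Type*} [CommRing A] {M : Type*} [AddCommGroup M] [Module A M]

/-- **Projector transport.** If `u ∈ A` acts as the scalar `N₀` on the sub-`A`-module `Y` and maps `M` into `Y`, then on the corner module the
same holds for the corner submodule `Y_e := {y ∈ M_e : y ∈ Y}`: `u` acts as `N₀` on it and maps `M_e` into it; and `N₀`-saturation of `Y` in
`M` gives `N₀`-saturation of `Y_e` in `M_e`. These are the hypotheses of `mem_of_forall_annihilator_smul_eq_zero` on `B_𝔪`, from the global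
(C2′) «`N₀·e_new ∈ 𝕋`, `X_r(J′)` saturated». Stated elementwise (the corner submodule is cut out by membership in `Y`).
[cite: BourbakiAlgebraI1989, Ch. II §1 no. 8] -/
theorem corner_projector {e : A} (he : IsIdempotentElem e) (Y : Submodule A M) (u N₀ : A)
    (hu : ∀ y ∈ Y, u • y = N₀ • y) (huM : ∀ m : M, u • m ∈ Y) (hsat : ∀ m : M, N₀ • m ∈ Y → m ∈ Y) :
    (∀ y ∈ Y, y ∈ torsionBySet A M (Ideal.span {1 - e} : Set A) → u • y = N₀ • y) ∧
      (∀ m ∈ torsionBySet A M (Ideal.span {1 - e} : Set A),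
        u • m ∈ Y ∧ u • m ∈ torsionBySet A M (Ideal.span {1 - e} : Set A)) ∧
      (∀ m ∈ torsionBySet A M (Ideal.span {1 - e} : Set A), N₀ • m ∈ Y → m ∈ Y) ∧
      (∀ y ∈ Y, e • y ∈ Y ∧ e • y ∈ torsionBySet A M (Ideal.span {1 - e} : Set A)) :=
  ⟨fun y hy _ ↦ hu y hy, fun m hm ↦ ⟨huM m, Submodule.smul_mem _ u hm⟩, fun m _ h ↦ hsat m h,
    fun y hy ↦ ⟨Y.smul_mem e hy, smul_mem_corner (M := M) he y⟩⟩

end Sub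

end Summit.BirchSwinnertonDyer.BirchSwinnertonDyer.Theorems.LeafPartnerOrders
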